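import Summits.QuantumFields.BalabanUV.T4Continuum.Support.SubstrateTransporterSpecies
import Summits.QuantumFields.BalabanUV.T4Continuum.Support.U3PolymerDictionaryNE9FaceD6

/-!
# NE9ChartFaceOperator — the NE9 CHART FACE, OPERATOR-DATUM HALF: the operator datum of the step of record SOURCED ON THE COMPLEX
# PAIR CHART (`expChart R⁰ A`, `expChartInv R⁰ A`) with the CUT-OFF TO THE VACUUM, its agreement with the real-slice sourcing map
# `oRecLast` AT THE CHART CENTRE, and the `act` slot of NE9's END fed at `Bg := TowerData P o`
# (cell `pub-balaban`, T4-DAG §2 node U3 ∕ §6 NE9; BINDER row NE9 OWNER lineage `b2b-balaban-t4-ne9-p1`, generation 31; substrate MAP v0.5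
# §O1 «D-8 RULED» (5) «CHART FACE = NE9 owner's, on p220490»; sheet `t4/b2b-balaban-t4-ne9-p1/g31/D8-ANSWER-NE9-g31.md` §3∕§4 (3))

HONEST FRAMING (T4-DAG PAGE 1).  Rung (B)+1 of the FINITE-VOLUME T⁴ programme — NOT infinite volume, NOT a mass gap, NOT the
Clay problem.  NE9 (`T4OutputRate.NE9` ∧ `FadingMemory`) is a cell NEW ESTIMATE, NOT PRINTED in [I] = [Balaban1987RG1] (CMP **109**),
[II] = [Balaban1988RG2Cluster] (CMP **116**), [B9] = [Balaban1985BackgroundPropagators] (CMP **99**), and NOT PROVED for Bałaban's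
E^{(j)} («NE9 ⇐ the named binders»; 0∕18 leaves instantiated on Bałaban's objects; spine PROVED 0∕9).  HONEST DEPENDENCY (cell
line, verbatim): continuum YM on T⁴ ⇐ BetaPertH ∧ nine spine estimates (0/9 proved); BetaPertH ⇐ (D1) ∧ (D4) ∧ CAP+tail; G-an2-4
gates asym, D1 and NE2/3/4.  `FlowStep.BetaPertH`, (B), (B^μ) do not occur.  DATA + identities only (no inequality, no `def … : Prop`,
no estimate); quotations for TYPES only (ABSOLUTE RULE); nothing of Bałaban's asserted.  0 sorry.

WHY THIS FILE.  NE9's END of record (`NE9SizeFedCouplingSpeciesReadOut…_fedA3`, p216114) takes `act : ℕ → ℝ → E → Pot → G.P → ℂ`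
with `E` a COMPLEX normed space, and is applied ONE CHART PER REAL BACKGROUND `U`, read at the centre (`NE9ChartFamilyPullback`,
p220529).  The substrate's D-8 half (`SubstrateTransporterSpecies`, p220490; MAP v0.5 «D-8 RULED») gives the species of record as
functions `rawTOfRecord … : (ℕ → ℝ) → TowerData P o × TowerData P o → ℕ → RawSpecies …` of TWO-SIDED tower transporter data
(`S ≙ U⁻¹`, [B9] Sect. B pp. 399–400 «U′U, U′ = e^{iηA}», p. 406), the pair chart `expChart R⁰ A ∕ expChartInv R⁰ A` per level, and
the real-slice agreement `rawOfRecord_eq_rawTOfRecord` at `(towerDataOf U, adjOf ∘ towerDataOf U)`.  THIS FILE is the NE9 owner's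
OPERATOR-DATUM half of the chart face:
* §1 (row-agnostic) `recOfChart raw ch` (the D-6 sourcing map `SubstrateRawSpecies.recOf` composed with a chart) and the
  **CUT-OFF TO THE VACUUM** `cutoff ρ ch vac A := if ‖A‖ ≤ ρ then ch A else vac` — identity on the closed ball (so the END's
  analyticity balls are untouched), the VACUUM pair beyond it (so the END's `∀ U : E` binders are bounds on the ball ∪ {vacuum}, and
  its vacuum-subtraction point `U₀` — [I] (2.14) p. 268 «log 𝐍″_k = 𝐄^{(k+1)}(g_k, 1)» — is ANY chart point beyond `ρ`, sheet (A4));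
* §2 (Slots-level) `oRecChart S raw ch k s A Q := assemble (S.F (k+1)) (recOfChart raw ch k s A)` — p219089's `oRecLast` with the
  background slot replaced by a chart; **`oRecChart_centre`**: at a chart point `A₀` with `ch A₀ = RS₀` and a run-B raw slot that IS the
  two-sided record at `RS₀` (`S.rawB g V k = raw g RS₀ k`), `oRecChart S raw ch k s A₀ Q = oRecLast S k s V Q`; the `act` slot of the
  END at the chart: `actChart S raw ch iRec := actNE9 S (oRecChart S raw ch) iRec : ℕ → ℝ → Bg → Pot → Finset (SCube R) → ℂ` (p218863's
  `actNE9` is `{Bg : Type}`-polymorphic — nothing new) + `newTerm_actChart` (p218863 §1 verbatim at the chart);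
* §3 (record level, on p220490) the TOWER pair chart `towerPairChart P R⁰ ρ : TowerData P o → TowerData P o × TowerData P o`
  (levelwise `expChart (R⁰ k) (A k)`, `expChartInv (R⁰ k) (A k)`, cut off to the vacuum pair `(1, 1)`; `TowerData P o` normed under the
  scope `Matrix.Norms.L2Operator` = MAP v0.5 Q-S13), **`towerPairChart_zero`** (centre ↦ `(R⁰, (R⁰)⁻¹)`), **`towerPairChart_zero_of_unitary`**
  (unitary `R⁰` ↦ `(R⁰, adjOf ∘ R⁰)` = the real slice), `towerDataOf_mem_unitaryGroup` (unitary-valued `ι`), the chart-level kernel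
  `rawTKernel … g RS k := (rawTOfRecord … g RS k).kernel`, **`rawOfRecord_kernel_eq_rawTKernel`** (real slice, from p220490), and the
  END-POINT: **`oRecC_zero`** — for a `Slots` whose run-B raw slot is the raw record of record with letters read through the tower data
  (`hraw`, = `SubstrateSlotsOfRecord.slotsOfRecord_rawB` for that choice of letters) at backgrounds embedded by `bg : R.carriers.BgB →
  GaugeField P 0 G` (= `Subtype.val` on the carriers of record), THE CHART-SOURCED OPERATOR DATUM AT THE CENTRE IS THE REAL-SLICE ONE:
  `oRecChart S (rawTKernel …) (towerPairChart P (towerDataOf P ι av (bg V)) ρ) k s 0 Q = oRecLast S k s V Q`.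
NOT HERE (named owners): holomorphy of `A ↦ rawTKernel … (towerPairChart … A)` entrywise on the regular set = S-HOLO-AN (substrate-p1)
+ the ball VECJ-H (substrate-p3); the TABLE half `iRecC` (ρ-image of the PIECE table) — after Q-S12′ (OBJ-NE9-g31-1); the species DATA
`CurData ∕ KerData` on the chart (D-8 (v)); the END application.  DISGUISE TEST: data + `rfl`∕`simp`-level identities; no estimate.

References (TYPES ∕ loci only): [Balaban1985BackgroundPropagators] T. Bałaban, CMP **99** (1985) 389–434, Sect. B pp. 399–400, p. 406;
[Balaban1987RG1] T. Bałaban, CMP **109** (1987) 249–301, (2.13)–(2.14) p. 268; [Balaban1988RG2Cluster] T. Bałaban, CMP **116** (1988) 1–22,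
(2.14) p. 15.  Summits-side NEW work (LEAN PLACEMENT RULE); imports `SubstrateTransporterSpecies` (p220490) and `U3PolymerDictionaryNE9FaceD6`
(p219089) BY NAME; modifies nothing.  Value = bookkeeping on the critical path of the row's instantiation, NOT summit progress.
-/

noncomputable section

open scoped BigOperators Matrix Matrix.Norms.L2Operator

namespace Summit.QuantumFields.BalabanUV.T4Continuum.NE9ChartFaceOperator

open Literature.MathematicalPhysics.QuantumFieldTheory.Balaban1983to89
open Literature.MathematicalPhysics.QuantumFieldTheory.Balaban1983to89.B5Prop11Plancherel (Tor fine)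
open Literature.MathematicalPhysics.QuantumFieldTheory.Balaban1983to89.B5G183RateUnitTower (lev)
open Summit.QuantumFields.BalabanUV.T4Continuum.CovariantBlockAveraging (ContourSystem)
open Summit.QuantumFields.BalabanUV.T4Continuum.B13Carriers (TwoRuns)
open Summit.QuantumFields.BalabanUV.T4Continuum.B13CarriersCubeChart (cubeChart)
open Summit.QuantumFields.BalabanUV.T4Continuum.B13DomainGeometryTR (SCube)
open Summit.QuantumFields.BalabanUV.T4Continuum.B13OpDatum (OpDatum RawSpecies Species assemble)
open Summit.QuantumFields.BalabanUV.T4Continuum.B13StepOfRecord (Slots)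
open Summit.QuantumFields.BalabanUV.T4Continuum.B13KPStepOfRecord (kpStep)
open Summit.QuantumFields.BalabanUV.T4Continuum.U3PolymerDictionaryNE9Face (actNE9 newTerm_actNE9 oRecLast)
open Summit.QuantumFields.BalabanUV.T4Continuum.SubstrateBackgroundTransporters (unitMod transV_mem_unitaryGroup)
open Summit.QuantumFields.BalabanUV.T4Continuum.SubstrateRawSpecies (LastCouplingOnly recOf raw_succ_eq_recOf rawOfRecord)
open Summit.QuantumFields.BalabanUV.T4Continuum.SubstrateTransporterSpecies

/-! ## §1 Chart-sourced D-6 maps and the cut-off to the vacuum (row-agnostic) -/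

section Generic

variable {Bg TD Sp : Type*}

/-- [folklore] **THE D-6 SOURCING MAP ON A CHART**: `recOfChart raw ch k s A := raw (const s) (ch A) (k + 1)` — the substrate's
`SubstrateRawSpecies.recOf raw` read at the chart point `ch A` (chart `ch : Bg → TD` into transporter data). -/
def recOfChart (raw : (ℕ → ℝ) → TD → ℕ → Sp) (ch : Bg → TD) : ℕ → ℝ → Bg → Sp := fun k s A => raw (fun _ => s) (ch A) (k + 1)

/-- [folklore] `recOfChart raw ch k s A = recOf raw k s (ch A)`. -/
theorem recOfChart_eq_recOf (raw : (ℕ → ℝ) → TD → ℕ → Sp) (ch : Bg → TD) (k : ℕ) (s : ℝ) (A : Bg) :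
    recOfChart raw ch k s A = recOf raw k s (ch A) := rfl

/-- [folklore] Under `LastCouplingOnly` the record at a chart point FACTORS through `recOfChart` at the last coupling. -/
theorem raw_chart_succ_eq_recOfChart {raw : (ℕ → ℝ) → TD → ℕ → Sp} (h : LastCouplingOnly raw) (ch : Bg → TD) (g : ℕ → ℝ)
    (A : Bg) (k : ℕ) : raw g (ch A) (k + 1) = recOfChart raw ch k (g k) A :=
  raw_succ_eq_recOf h g (ch A) k

variable [Norm Bg]

/-- [folklore] **THE CUT-OFF TO THE VACUUM**: the chart `ch` on the closed ball of radius `ρ`, the VACUUM datum `vac` beyond it.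
Identity on the ball (the END's analyticity balls are untouched); makes the END's `∀ U : E` binders statements on the ball ∪ {vacuum};
any point beyond `ρ` serves as the END's vacuum-subtraction point `U₀` ([I] (2.14) p. 268: the subtraction is at the TRIVIAL background).
[cite: Balaban1987RG1, (2.13)-(2.14) p.268] -/
def cutoff (ρ : ℝ) (ch : Bg → TD) (vac : TD) : Bg → TD := fun A => if ‖A‖ ≤ ρ then ch A else vac

/-- [folklore] On the closed ball the cut-off chart IS the chart. -/
theorem cutoff_of_le {ρ : ℝ} (ch : Bg → TD) (vac : TD) {A : Bg} (h : ‖A‖ ≤ ρ) : cutoff ρ ch vac A = ch A := by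
  simp [cutoff, h]

/-- [folklore] Beyond the ball the cut-off chart reads the vacuum datum. -/
theorem cutoff_of_lt {ρ : ℝ} (ch : Bg → TD) (vac : TD) {A : Bg} (h : ρ < ‖A‖) : cutoff ρ ch vac A = vac := by
  simp [cutoff, not_le.mpr h]

end Generic

/-- [folklore] At the CENTRE (`‖0‖ = 0 ≤ ρ`) the cut-off chart is the chart. -/
theorem cutoff_zero {Bg TD : Type*} [SeminormedAddCommGroup Bg] {ρ : ℝ} (hρ : 0 ≤ ρ) (ch : Bg → TD) (vac : TD) :
    cutoff ρ ch vac 0 = ch 0 :=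
  cutoff_of_le ch vac (by simpa using hρ)

/-! ## §2 The chart-sourced operator datum and the `act` slot of the END at a chart (Slots level) -/

section SlotsLevel

variable {G : Type} [GaugeGroup G] {R : TwoRuns G} {E : Type} {IOp Hist : Type*} [NormedAddCommGroup Hist] [NormedSpace ℂ Hist]
  (S : Slots R E IOp Hist)

/-- [folklore] DATA: **THE OPERATOR-DATUM SOURCING MAP ON A CHART** — `oRecLast` (p219089) with the background slot replaced by a chart
`ch : Bg → TD` into (two-sided) transporter data and the run-B raw slot replaced by a record `raw` ON that data:
`oRecChart S raw ch k s A Q := assemble (S.F (k+1)) (raw (const s) (ch A) (k+1))`; the table `Q` is not read (D-6). -/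
def oRecChart {Bg TD : Type} {Pot : Type*} (raw : (ℕ → ℝ) → TD → ℕ → E → ℂ) (ch : Bg → TD) :
    ℕ → ℝ → Bg → Pot → OpDatum E :=
  fun k s A _ => assemble (S.F (k + 1)) (recOfChart raw ch k s A)

variable {S} in
/-- [folklore] `oRecChart` unfolds. -/
theorem oRecChart_apply {Bg TD : Type} {Pot : Type*} (raw : (ℕ → ℝ) → TD → ℕ → E → ℂ) (ch : Bg → TD) (k : ℕ) (s : ℝ)
    (A : Bg) (Q : Pot) : oRecChart S raw ch k s A Q = assemble (S.F (k + 1)) (raw (fun _ => s) (ch A) (k + 1)) := rfl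

variable {S} in
/-- [folklore] **AGREEMENT AT THE CENTRE (Slots level).**  If the chart sends `A₀` to the data `RS₀` and the run-B raw slot of `S` at
the real background `V` IS the record `raw` at `RS₀` (the substrate's real-slice agreement, e.g. `rawOfRecord_eq_rawTOfRecord`), then the
chart-sourced operator datum at `A₀` is the real-slice one: `oRecChart S raw ch k s A₀ Q = oRecLast S k s V Q`. -/
theorem oRecChart_centre {Bg TD : Type} {Pot : Type*} {raw : (ℕ → ℝ) → TD → ℕ → E → ℂ} {ch : Bg → TD} {A₀ : Bg} {RS₀ : TD}
    {V : R.carriers.BgB} (hch : ch A₀ = RS₀) (hraw : ∀ (g : ℕ → ℝ) (k : ℕ), S.rawB g V k = raw g RS₀ k) (k : ℕ) (s : ℝ)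
    (Q : Pot) : oRecChart S raw ch k s A₀ Q = oRecLast S k s V Q := by
  rw [oRecChart_apply, hch, ← hraw]
  rfl

/-- [folklore] DATA: **THE `act` SLOT OF NE9's END AT A CHART** — p218863's `actNE9` (polymorphic in the background slot) at the
chart-sourced operator datum and any inserted-history sourcing map `iRec` on the chart:
`actChart S raw ch iRec : ℕ → ℝ → Bg → Pot → Finset (SCube R) → ℂ`. [cite: Balaban1988RG2Cluster, (2.14) p.15] -/
def actChart {Bg TD : Type} {Pot : Type*} (raw : (ℕ → ℝ) → TD → ℕ → E → ℂ) (ch : Bg → TD)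
    (iRec : ℕ → ℝ → Bg → Pot → Hist) : ℕ → ℝ → Bg → Pot → Finset (SCube R) → ℂ :=
  actNE9 S (oRecChart S raw ch) iRec

/-- [folklore] **THE NEW TERM OF `actChart` IS NE5's KP-FORM OUTPUT OF RECORD at the chart-sourced datum** (p218863 §1 `newTerm_actNE9`
at the chart — the `act` slot typed once serves the chart row too). -/
theorem newTerm_actChart {Bg TD : Type} {Pot : Type*} (E₀ cB : ℝ) (raw : (ℕ → ℝ) → TD → ℕ → E → ℂ) (ch : Bg → TD)
    (iRec : ℕ → ℝ → Bg → Pot → Hist) (k : ℕ) (s : ℝ) (A : Bg) (X : R.carriers.Dom) (Q : Pot) :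
    (cubeChart R).geom.newTerm (actChart S raw ch iRec) k s A X Q =
      (kpStep S E₀ cB).Out (k + 1) (oRecChart S raw ch k s A Q) (iRec k s A Q) X :=
  newTerm_actNE9 S E₀ cB (oRecChart S raw ch) iRec k s A X Q

end SlotsLevel

/-! ## §3 Record level (on p220490): the tower pair chart with the vacuum cut-off, its centre, and `oRecC_zero` -/

section Record

variable (P : Params) {G : Type} [GaugeGroup G] {o : Type} [Fintype o] [DecidableEq o] (ι : G →* Matrix o o ℂ)
  (av : ∀ j, Averaging P j G)

/-- [folklore] DATA: the levelwise exponential chart on tower data, `(towerExpChart R⁰ A) k := expChart (R⁰ k) (A k)`.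
[cite: Balaban1985BackgroundPropagators, Sect. B p.399] -/
def towerExpChart (R₀ A : TowerData P o) : TowerData P o := fun k => expChart (R₀ k) (A k)

/-- [folklore] DATA: the levelwise inverse-side chart, `(towerExpChartInv R⁰ A) k := expChartInv (R⁰ k) (A k)`. -/
def towerExpChartInv (R₀ A : TowerData P o) : TowerData P o := fun k => expChartInv (R₀ k) (A k)

/-- [folklore] DATA: the VACUUM pair of tower data — every transporter the identity (the trivial background `U = 1` after `ι`, both sides).
[cite: Balaban1987RG1, (2.14) p.268] -/
def vacPair : TowerData P o × TowerData P o := (fun _ _ _ => 1, fun _ _ _ => 1)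

/-- [folklore] DATA: **THE TOWER PAIR CHART WITH THE CUT-OFF TO THE VACUUM** at the reference tower `R⁰`, radius `ρ`:
`A ↦ (towerExpChart R⁰ A, towerExpChartInv R⁰ A)` on `‖A‖ ≤ ρ`, the vacuum pair beyond (`TowerData P o` normed by the Pi-sup of the
scoped `Matrix.Norms.L2Operator` instances — MAP v0.5 Q-S13). [cite: Balaban1985BackgroundPropagators, Sect. B pp.399-400] -/
def towerPairChart (R₀ : TowerData P o) (ρ : ℝ) : TowerData P o → TowerData P o × TowerData P o :=
  cutoff ρ (fun A => (towerExpChart P R₀ A, towerExpChartInv P R₀ A)) (vacPair P)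

/-- [folklore] **THE CENTRE OF THE TOWER PAIR CHART**: `towerPairChart R⁰ ρ 0 = (R⁰, (R⁰)⁻¹)` (levelwise, pointwise inverse), `0 ≤ ρ`. -/
theorem towerPairChart_zero (R₀ : TowerData P o) {ρ : ℝ} (hρ : 0 ≤ ρ) :
    towerPairChart P R₀ ρ 0 = (R₀, fun k ν i => (R₀ k ν i)⁻¹) := by
  rw [towerPairChart, cutoff_zero hρ]
  refine Prod.ext ?_ ?_
  · funext k; exact expChart_zero (R₀ k)
  · funext k; exact expChartInv_zero (R₀ k)

/-- [folklore] **… AND ON THE GROUP IT IS THE REAL SLICE**: for levelwise UNITARY `R⁰`, `towerPairChart R⁰ ρ 0 = (R⁰, adjOf ∘ R⁰)`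
(`adjOf_eq_inv`: `U* = U⁻¹`). [cite: Balaban1985BackgroundPropagators, Sect. B p.399] -/
theorem towerPairChart_zero_of_unitary {R₀ : TowerData P o} (hR : ∀ k ν i, R₀ k ν i ∈ Matrix.unitaryGroup o ℂ) {ρ : ℝ}
    (hρ : 0 ≤ ρ) : towerPairChart P R₀ ρ 0 = (R₀, fun k => adjOf (R₀ k)) := by
  rw [towerPairChart_zero P R₀ hρ]
  refine Prod.ext rfl ?_
  funext k
  exact (adjOf_eq_inv (hR k)).symm

/-- [folklore] Beyond the cut-off radius the chart reads the vacuum pair. -/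
theorem towerPairChart_of_lt (R₀ : TowerData P o) {ρ : ℝ} {A : TowerData P o} (h : ρ < ‖A‖) :
    towerPairChart P R₀ ρ A = vacPair P :=
  cutoff_of_lt _ _ h

/-- [folklore] The tower data of record of a configuration are levelwise UNITARY when `ι` is unitary-valued. -/
theorem towerDataOf_mem_unitaryGroup (hι : ∀ g, ι g ∈ Matrix.unitaryGroup o ℂ) (U : GaugeField P 0 G) (k : Fin (P.K + 1))
    (ν : Fin P.d) (i : Tor (fine (lev P.L k) (unitMod P)) × Fin P.d) : towerDataOf P ι av U k ν i ∈ Matrix.unitaryGroup o ℂ := by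
  unfold towerDataOf
  exact transV_mem_unitaryGroup _ hι _ ν i

variable (c : ℂ) (a : ℝ) (s : ℕ → ℂ) (Γ : (k : ℕ) → ContourSystem P.d (lev P.L k) (unitMod P)) {T ι' Ω 𝒴 : Type}
  (dk : TowerData P o → TowerData P o → ℕ → T → ι' → ι' → ℂ)
  (gc : TowerData P o → TowerData P o → ℕ → T → ((Tor (unitMod P) × Fin P.d) × o) → ι' → ℂ)
  (pQ : ℝ → TowerData P o → TowerData P o → ℕ → Ω → 𝒴 → ((Tor (unitMod P) × Fin P.d) × o) → ((Tor (unitMod P) × Fin P.d) × o) → ℂ)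
  (pR : ℝ → TowerData P o → TowerData P o → ℕ → Ω → 𝒴 → ℂ)

/-- [folklore] DATA: **THE CHART-LEVEL RAW KERNEL OF RECORD** — the entry kernel of the two-sided raw record `rawTOfRecord` (p220490):
`rawTKernel … g RS k := (rawTOfRecord … g RS k).kernel`. -/
def rawTKernel : (ℕ → ℝ) → TowerData P o × TowerData P o → ℕ →
    Species T ((Tor (unitMod P) × Fin P.d) × o) ι' Ω 𝒴 → ℂ :=
  fun g RS k => (rawTOfRecord P c a s Γ dk gc pQ pR g RS k).kernel

/-- [folklore] D-6 for the chart-level raw kernel (from `lastCouplingOnly_rawTOfRecord`). -/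
theorem lastCouplingOnly_rawTKernel : LastCouplingOnly (rawTKernel P c a s Γ dk gc pQ pR) := by
  intro g g' RS k hg
  simp only [rawTKernel, lastCouplingOnly_rawTOfRecord P c a s Γ g g' RS k hg]

/-- [folklore] **REAL SLICE OF THE RAW KERNEL (from p220490 `rawOfRecord_eq_rawTOfRecord`)**: with letters read through the tower data,
the raw record of record at `U` has the kernel of the chart-level record at `(towerDataOf U, adjOf ∘ towerDataOf U)`. -/
theorem rawOfRecord_kernel_eq_rawTKernel (g : ℕ → ℝ) (U : GaugeField P 0 G) (k : ℕ) :
    (rawOfRecord P ι av c a s Γ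
        (fun U k => dk (towerDataOf P ι av U) (fun k => adjOf (towerDataOf P ι av U k)) k)
        (fun U k => gc (towerDataOf P ι av U) (fun k => adjOf (towerDataOf P ι av U k)) k)
        (fun r U k => pQ r (towerDataOf P ι av U) (fun k => adjOf (towerDataOf P ι av U k)) k)
        (fun r U k => pR r (towerDataOf P ι av U) (fun k => adjOf (towerDataOf P ι av U k)) k) g U k).kernel =
      rawTKernel P c a s Γ dk gc pQ pR g (towerDataOf P ι av U, fun k => adjOf (towerDataOf P ι av U k)) k := by
  rw [rawTKernel, rawOfRecord_eq_rawTOfRecord]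

variable {R : TwoRuns G} {IOp Hist : Type*} [NormedAddCommGroup Hist] [NormedSpace ℂ Hist]

/-- [folklore] **THE END-POINT OF THE OPERATOR HALF — AGREEMENT AT THE CENTRE, RECORD LEVEL.**  Let `S` be a `Slots` on two runs `R`
whose run-B raw slot IS the raw record of record with letters read through the tower data, at backgrounds embedded by
`bg : R.carriers.BgB → GaugeField P 0 G` (hypothesis `hraw`; for `SubstrateSlotsOfRecord.slotsOfRecord` with these letters it is
`slotsOfRecord_rawB`, `bg = Subtype.val`), `ι` unitary-valued, `0 ≤ ρ`.  Then the operator datum SOURCED ON THE TOWER PAIR CHART centred at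
`towerDataOf (bg V)`, read AT THE CENTRE, is the real-slice operator datum of record:
`oRecChart S (rawTKernel …) (towerPairChart (towerDataOf (bg V)) ρ) k s 0 Q = oRecLast S k s V Q`.
[cite: Balaban1985BackgroundPropagators, Sect. B pp.399-400] -/
theorem oRecC_zero {Pot : Type*} (hι : ∀ g, ι g ∈ Matrix.unitaryGroup o ℂ)
    (S : Slots R (Species T ((Tor (unitMod P) × Fin P.d) × o) ι' Ω 𝒴) IOp Hist) (bg : R.carriers.BgB → GaugeField P 0 G)
    (hraw : ∀ (g : ℕ → ℝ) (V : R.carriers.BgB) (k : ℕ), S.rawB g V k =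
      (rawOfRecord P ι av c a s Γ
        (fun U k => dk (towerDataOf P ι av U) (fun k => adjOf (towerDataOf P ι av U k)) k)
        (fun U k => gc (towerDataOf P ι av U) (fun k => adjOf (towerDataOf P ι av U k)) k)
        (fun r U k => pQ r (towerDataOf P ι av U) (fun k => adjOf (towerDataOf P ι av U k)) k)
        (fun r U k => pR r (towerDataOf P ι av U) (fun k => adjOf (towerDataOf P ι av U k)) k) g (bg V) k).kernel)
    {ρ : ℝ} (hρ : 0 ≤ ρ) (V : R.carriers.BgB) (k : ℕ) (s' : ℝ) (Q : Pot) :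
    oRecChart S (rawTKernel P c a s Γ dk gc pQ pR) (towerPairChart P (towerDataOf P ι av (bg V)) ρ) k s' 0 Q =
      oRecLast S k s' V Q :=
  oRecChart_centre (towerPairChart_zero_of_unitary P (fun k ν i => towerDataOf_mem_unitaryGroup P ι av hι (bg V) k ν i) hρ)
    (fun g k => by rw [hraw, rawOfRecord_kernel_eq_rawTKernel]) k s' Q

/-- [folklore] **BEYOND THE CUT-OFF THE CHART-SOURCED DATUM IS THE VACUUM DATUM** (the END's `U₀`): for `ρ < ‖A‖`,
`oRecChart S (rawTKernel …) (towerPairChart R⁰ ρ) k s A Q = assemble (S.F (k+1)) (rawTKernel … (const s) vacPair (k+1))`.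
[cite: Balaban1987RG1, (2.14) p.268] -/
theorem oRecC_of_lt {Pot : Type*} (S : Slots R (Species T ((Tor (unitMod P) × Fin P.d) × o) ι' Ω 𝒴) IOp Hist)
    (R₀ : TowerData P o) {ρ : ℝ} {A : TowerData P o} (h : ρ < ‖A‖) (k : ℕ) (s' : ℝ) (Q : Pot) :
    oRecChart S (rawTKernel P c a s Γ dk gc pQ pR) (towerPairChart P R₀ ρ) k s' A Q =
      assemble (S.F (k + 1)) (rawTKernel P c a s Γ dk gc pQ pR (fun _ => s') (vacPair P) (k + 1)) := by
  rw [oRecChart_apply, towerPairChart_of_lt P R₀ h]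

end Record

end Summit.QuantumFields.BalabanUV.T4Continuum.NE9ChartFaceOperator

end
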